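import Summits.KontsevichZagierPeriods.KontsevichZagierPeriods.Theses.LiftingCriteria
import Summits.KontsevichZagierPeriods.KontsevichZagierPeriods.Theorems.LiftingCriteriaDilationLiftAtOneTwistedDiagonal
import Literature.NumberTheory.Transcendental.KZDilationLiouvilleSector

/-!
# `DilationLiftAtOne` holds on the Liouville sector (crux stmt-KontsevichZagierPeriods-3571, route
LiftingCriteria, line `registered`, registered stub `stub_liouvilleSector`)

**Theorem (unconditional, `dilationLiftAtOne_liouvilleSector`).** Let `N` be Nash on
`(a,b) ⊇ [0,1]`, `w_k = u_k + iv_k` (`k < A`) Nash loops on `(a,b)` in the slit plane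
(`0 < u_k ∨ v_k ≠ 0`), `c_k = γ_k + iδ_k` algebraic, and
  `g = N' + Σ_k Re(c_k w_k'/w_k) = N' + Σ_k [γ_k (u_k'u_k + v_k'v_k) − δ_k (v_k'u_k − u_k'v_k)]/(u_k² + v_k²)`
— the LIOUVILLE NORMAL FORM of a one-variable algebraic integrand with elementary antiderivative
`∫ g = N + Σ c_k log w_k` (Liouville's theorem); it contains every genus-0 datum and every rational
`P/Q ∈ ℚ(x)` (affine loops). If `m₀ + m·∫₀¹ g = 0` (`m₀, m ∈ ℤ`) then the dilation G-function
`m₀ + m·v_g` factors on `[0,1]` as `(ϖ − 1)·m·v_G(ϖ)` with ONE Nash cube function `G` of two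
variables — the conclusion of the crux for this datum. Chain: (S3⁵) `stub_liouvilleSector` = Literature
`KZ.dilationLiouvilleSector_lift` (files `KZDilationLiouville{Relations,Prep,Lifts,Sector}.lean`:
Baker's theorem on DIFFERENCES `Log w_k(1) − Log w_k(0)` — any determination of the logarithm is
admissible in `baker_decomposition_complex`, so no branch bookkeeping —, normalised moduli
`|w_k|²/|w_k(0)|²` through the logarithmic sector, Möbius-normalised angle halving through the
arctangent sector); (S4) `stub_twistedDiagonal`. This extends the unconditional reach of the route from
`ℚ(x)` to the boundary of Baker's theorem: all one-variable data whose antiderivative is elementary.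
-/

noncomputable section

open scoped BigOperators

namespace Summit.KontsevichZagierPeriods.LiftingCriteria.DilationLiftAtOne

/-- **Stub `stub_liouvilleSector` of the registered skeleton of crux stmt-KontsevichZagierPeriods-3571
(line `registered`, reshape 5 by lead c2): the Liouville sector of the glue holds unconditionally.**
Verbatim the registered signature; proof = `Literature.NumberTheory.Transcendental.KZ.dilationLiouvilleSector_lift`.
[cite: Baker1975, Theorem 2.1] -/
theorem stub_liouvilleSector :
    ∀ (a b : ℝ), a < 0 → 1 < b → ∀ (N : ℝ → ℝ), Literature.NumberTheory.Transcendental.IsSemialgebraicFunOn ℚ {t : Fin 1 → ℝ | t 0 ∈ Set.Ioo a b} (fun t => N (t 0)) → (∀ x ∈ Set.Ioo a b, AnalyticAt ℝ N x) → ∀ (A : ℕ) (u v : Fin A → ℝ → ℝ), (∀ k, Literature.NumberTheory.Transcendental.IsSemialgebraicFunOn ℚ {t : Fin 1 → ℝ | t 0 ∈ Set.Ioo a b} (fun t => u k (t 0))) → (∀ k, Literature.NumberTheory.Transcendental.IsSemialgebraicFunOn ℚ {t : Fin 1 → ℝ | t 0 ∈ Set.Ioo a b} (fun t => v k (t 0)))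 → (∀ k, ∀ x ∈ Set.Ioo a b, AnalyticAt ℝ (u k) x) → (∀ k, ∀ x ∈ Set.Ioo a b, AnalyticAt ℝ (v k) x) → (∀ k, ∀ x ∈ Set.Ioo a b, 0 < u k x ∨ v k x ≠ 0) → ∀ (γ δ : Fin A → ℝ), (∀ k, IsAlgebraic ℚ (γ k)) → (∀ k, IsAlgebraic ℚ (δ k)) → (∫ z in Set.pi Set.univ (fun _ : Fin 1 => Set.Icc (0:ℝ) 1), (deriv N (((1:ℝ) • z) 0) + ∑ k, (γ k * ((deriv (u k) (((1:ℝ) • z) 0) * u k (((1:ℝ) • z) 0) + deriv (v k) (((1:ℝ) • z) 0) * v k (((1:ℝ) • z) 0)) / (u k (((1:ℝ) • z) 0) ^ 2 + v k (((1:ℝ) • z) 0) ^ 2)) - δ k * ((deriv (v k) (((1:ℝ) • z) 0) * u k (((1:ℝ) • z) 0) - deriv (u k) (((1:ℝ) • z) 0) * v k (((1:ℝ) • z) 0)) / (u k (((1:ℝ) • z) 0) ^ 2 + v k (((1:ℝ) • z) 0) ^ 2))))) = 0 → ∃ (K : (Fin 2 → ℝ) → ℝ) (V : Set (Fin 2 →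 ℝ)), IsOpen V ∧ (∀ ϖ ∈ Set.Icc (0:ℝ) 1, ∀ x ∈ Set.pi Set.univ (fun _ : Fin 1 => Set.Icc (0:ℝ) 1), Matrix.vecCons ϖ x ∈ V) ∧ Literature.NumberTheory.Transcendental.IsSemialgebraicFunOn ℚ V K ∧ AnalyticOnNhd ℝ K V ∧ ∀ ϖ ∈ Set.Icc (0:ℝ) 1, (∫ z in Set.pi Set.univ (fun _ : Fin 1 => Set.Icc (0:ℝ) 1), (deriv N ((ϖ • z) 0) + ∑ k, (γ k * ((deriv (u k) ((ϖ • z) 0) * u k ((ϖ • z) 0) + deriv (v k) ((ϖ • z) 0) * v k ((ϖ • z) 0)) / (u k ((ϖ • z) 0) ^ 2 + v k ((ϖ • z) 0) ^ 2)) - δ k * ((deriv (v k) ((ϖ • z) 0) * u k ((ϖ • z) 0) - deriv (u k) ((ϖ • z) 0) * v k ((ϖ • z) 0)) / (u k ((ϖ • z) 0) ^ 2 + v k ((ϖ • z) 0) ^ 2))))) = (ϖ - 1) * ∫ y in Set.pi Set.univ (fun _ : Fin 1 => Set.Icc (0:ℝ) 1), K (Matrix.vecCons ϖ (ϖ • y))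 :=
  fun _ _ ha hb _ hNs hNa _ _ _ hus hvs hua hva hslit _ _ hγ hδ hsum =>
    Literature.NumberTheory.Transcendental.KZ.dilationLiouvilleSector_lift ha hb hNs hNa hus hvs hua hva
      hslit hγ hδ hsum

/-- **`DilationLiftAtOne` on the Liouville sector (unconditional).** See the module docstring: for
a datum `g` in Liouville normal form with `m₀ + m ∫₀¹ g = 0`, `m₀ + m·v_g = (ϖ − 1)·m·v_G` on `[0,1]`
with one Nash cube function `G` of two variables (`T = 1`, `μ = m`, `μ₀ = 0`) — the conclusion of
the crux for this datum. (For `m ≠ 0` the constant `m₀/m` is absorbed into the exact part: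
`Ñ = N + (m₀/m)x` is again Nash and `m₀ + m·v_g = m·v_{g̃}`, `g̃ = g + m₀/m`, `∫₀¹ g̃ = 0`.)
[cite: KontsevichZagier2001, §1.2] -/
theorem dilationLiftAtOne_liouvilleSector (a b : ℝ) (ha : a < 0) (hb : 1 < b) (N : ℝ → ℝ)
    (hNs : Literature.NumberTheory.Transcendental.IsSemialgebraicFunOn ℚ
      {t : Fin 1 → ℝ | t 0 ∈ Set.Ioo a b} (fun t => N (t 0)))
    (hNa : ∀ x ∈ Set.Ioo a b, AnalyticAt ℝ N x) (A : ℕ) (u v : Fin A → ℝ → ℝ)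
    (hus : ∀ k, Literature.NumberTheory.Transcendental.IsSemialgebraicFunOn ℚ
      {t : Fin 1 → ℝ | t 0 ∈ Set.Ioo a b} (fun t => u k (t 0)))
    (hvs : ∀ k, Literature.NumberTheory.Transcendental.IsSemialgebraicFunOn ℚ
      {t : Fin 1 → ℝ | t 0 ∈ Set.Ioo a b} (fun t => v k (t 0)))
    (hua : ∀ k, ∀ x ∈ Set.Ioo a b, AnalyticAt ℝ (u k) x)
    (hva : ∀ k, ∀ x ∈ Set.Ioo a b, AnalyticAt ℝ (v k) x)
    (hslit : ∀ k, ∀ x ∈ Set.Ioo a b, 0 < u k x ∨ v k x ≠ 0)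
    (γ δ : Fin A → ℝ) (hγ : ∀ k, IsAlgebraic ℚ (γ k)) (hδ : ∀ k, IsAlgebraic ℚ (δ k))
    (m m₀ : ℤ)
    (hsum : (m₀ : ℝ) + (m : ℝ) * (∫ z in Set.pi Set.univ (fun _ : Fin 1 => Set.Icc (0:ℝ) 1),
      (deriv N (((1:ℝ) • z) 0) + ∑ k,
        (γ k * ((deriv (u k) (((1:ℝ) • z) 0) * u k (((1:ℝ) • z) 0) +
            deriv (v k) (((1:ℝ) • z) 0) * v k (((1:ℝ) • z) 0)) /
            (u k (((1:ℝ) • z) 0) ^ 2 + v k (((1:ℝ) • z) 0) ^ 2)) -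
          δ k * ((deriv (v k) (((1:ℝ) • z) 0) * u k (((1:ℝ) • z) 0) -
            deriv (u k) (((1:ℝ) • z) 0) * v k (((1:ℝ) • z) 0)) /
            (u k (((1:ℝ) • z) 0) ^ 2 + v k (((1:ℝ) • z) 0) ^ 2))))) = 0) :
    ∃ (T : ℕ) (d : Fin T → ℕ) (G : (j : Fin T) → (Fin (d j) → ℝ) → ℝ)
      (V : (j : Fin T) → Set (Fin (d j) → ℝ)) (μ : Fin T → Polynomial ℝ) (μ₀ : Polynomial ℝ),
      (∀ j, IsOpen (V j) ∧ Set.pi Set.univ (fun _ : Fin (d j) => Set.Icc (0:ℝ) 1) ⊆ (V j) ∧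
        Literature.NumberTheory.Transcendental.IsSemialgebraicFunOn ℚ (V j) (G j) ∧
        AnalyticOnNhd ℝ (G j) (V j)) ∧
      (∀ j k, IsAlgebraic ℚ ((μ j).coeff k)) ∧ (∀ k, IsAlgebraic ℚ (μ₀.coeff k)) ∧
      ∀ ϖ ∈ Set.Icc (0:ℝ) 1, (m₀ : ℝ) + (m : ℝ) *
          (∫ z in Set.pi Set.univ (fun _ : Fin 1 => Set.Icc (0:ℝ) 1),
            (deriv N ((ϖ • z) 0) + ∑ k,
              (γ k * ((deriv (u k) ((ϖ • z) 0) * u k ((ϖ • z) 0) +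
                  deriv (v k) ((ϖ • z) 0) * v k ((ϖ • z) 0)) /
                  (u k ((ϖ • z) 0) ^ 2 + v k ((ϖ • z) 0) ^ 2)) -
                δ k * ((deriv (v k) ((ϖ • z) 0) * u k ((ϖ • z) 0) -
                  deriv (u k) ((ϖ • z) 0) * v k ((ϖ • z) 0)) /
                  (u k ((ϖ • z) 0) ^ 2 + v k ((ϖ • z) 0) ^ 2))))) =
        (ϖ - 1) * (μ₀.eval ϖ + ∑ j, (μ j).eval ϖ *
          (∫ z in Set.pi Set.univ (fun _ : Fin (d j) => Set.Icc (0:ℝ) 1), G j (ϖ • z))) := by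
  classical
  have h0I : (0:ℝ) ∈ Set.Ioo a b := ⟨ha, zero_lt_one.trans hb⟩
  -- abbreviation: the logarithmic-derivative part of the integrand
  set σ : ℝ → ℝ := fun x => ∑ k,
    (γ k * ((deriv (u k) x * u k x + deriv (v k) x * v k x) / (u k x ^ 2 + v k x ^ 2)) -
      δ k * ((deriv (v k) x * u k x - deriv (u k) x * v k x) / (u k x ^ 2 + v k x ^ 2))) with hσ
  by_cases hm0 : m = 0
  · -- trivial combination: `m₀ = 0` and everything vanishes
    subst hm0
    have hm₀ : (m₀ : ℝ) = 0 := by simpa using hsum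
    refine ⟨0, Fin.elim0, fun j => Fin.elim0 j, fun j => Fin.elim0 j, Fin.elim0, 0,
      fun j => Fin.elim0 j, fun j => Fin.elim0 j, ?_, ?_⟩
    · intro k
      rw [Polynomial.coeff_zero]
      exact isAlgebraic_zero
    · intro ϖ hϖ
      simp [hm₀]
  · -- `m ≠ 0`: absorb the constant `m₀/m` into the exact part
    have hm' : (m : ℝ) ≠ 0 := by exact_mod_cast hm0
    set c : ℝ := (m₀ : ℝ) / (m : ℝ) with hc
    have hcalg : IsAlgebraic ℚ c := by
      have : c = ((m₀ / m : ℚ) : ℝ) := by simp [hc]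
      rw [this]; exact isAlgebraic_algebraMap _
    set Nt : ℝ → ℝ := fun x => N x + c * x with hNt
    have hNts : Literature.NumberTheory.Transcendental.IsSemialgebraicFunOn ℚ
        {t : Fin 1 → ℝ | t 0 ∈ Set.Ioo a b} (fun t => Nt (t 0)) := by
      have hI := Literature.NumberTheory.Transcendental.IsSemialgebraicFunOn.isSemialgebraic_holds hNs
      have hx : Literature.NumberTheory.Transcendental.IsSemialgebraicFunOn ℚ
          {t : Fin 1 → ℝ | t 0 ∈ Set.Ioo a b} (fun t => t 0) := by
        simpa using Literature.NumberTheory.Transcendental.isSemialgebraicFunOn_aeval hI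
          (MvPolynomial.X 0 : MvPolynomial (Fin 1) ℚ)
      exact hNs.fun_add
        ((Literature.NumberTheory.Transcendental.isSemialgebraicFunOn_const_of_isAlgebraic hI hcalg).fun_mul hx)
    have hNta : ∀ x ∈ Set.Ioo a b, AnalyticAt ℝ Nt x := fun x hx =>
      (hNa x hx).add (analyticAt_const.mul analyticAt_id)
    have hderiv : ∀ x ∈ Set.Ioo a b, deriv Nt x = deriv N x + c := by
      intro x hx
      have h1 : HasDerivAt N (deriv N x) x := (hNa x hx).differentiableAt.hasDerivAt
      have h2 : HasDerivAt (fun y => c * y) c x := by simpa using (hasDerivAt_id x).const_mul c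
      exact (h1.add h2).deriv
    -- the dilated integrals of the two integrands differ by `c`
    have hdil : ∀ ϖ ∈ Set.Icc (0:ℝ) 1, ∀ z ∈ Set.pi Set.univ (fun _ : Fin 1 => Set.Icc (0:ℝ) 1),
        (ϖ • z) 0 ∈ Set.Ioo a b := by
      intro ϖ hϖ z hz
      have hz0 : z 0 ∈ Set.Icc (0:ℝ) 1 := (Set.mem_univ_pi.mp hz) 0
      refine ⟨lt_of_lt_of_le ha ?_, lt_of_le_of_lt ?_ hb⟩
      · simpa using mul_nonneg hϖ.1 hz0.1
      · simpa using mul_le_one₀ hϖ.2 hz0.1 hz0.2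
    have hσc : ContinuousOn σ (Set.Ioo a b) := by
      have huc : ∀ k, ContinuousOn (u k) (Set.Ioo a b) := fun k x hx =>
        (hua k x hx).continuousAt.continuousWithinAt
      have hvc : ∀ k, ContinuousOn (v k) (Set.Ioo a b) := fun k x hx =>
        (hva k x hx).continuousAt.continuousWithinAt
      have hu'c : ∀ k, ContinuousOn (deriv (u k)) (Set.Ioo a b) := fun k x hx =>
        (hua k x hx).deriv.continuousAt.continuousWithinAt
      have hv'c : ∀ k, ContinuousOn (deriv (v k)) (Set.Ioo a b) := fun k x hx =>
        (hva k x hx).deriv.continuousAt.continuousWithinAt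
      have hm0' : ∀ k, ∀ x ∈ Set.Ioo a b, u k x ^ 2 + v k x ^ 2 ≠ 0 := fun k x hx =>
        (Literature.NumberTheory.Transcendental.KZ.LiouvilleSector.modSq_pos (hslit k x hx)).ne'
      refine continuousOn_finsetSum _ fun k _ => ?_
      refine (continuousOn_const.mul ((((hu'c k).mul (huc k)).add ((hv'c k).mul (hvc k))).div
        (((huc k).pow 2).add ((hvc k).pow 2)) (hm0' k))).sub
        (continuousOn_const.mul ((((hv'c k).mul (huc k)).sub ((hu'c k).mul (hvc k))).div
        (((huc k).pow 2).add ((hvc k).pow 2)) (hm0' k)))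
    have hN'c : ContinuousOn (deriv N) (Set.Ioo a b) := fun x hx =>
      (hNa x hx).deriv.continuousAt.continuousWithinAt
    have hshift : ∀ ϖ ∈ Set.Icc (0:ℝ) 1,
        (∫ z in Set.pi Set.univ (fun _ : Fin 1 => Set.Icc (0:ℝ) 1),
          (deriv Nt ((ϖ • z) 0) + σ ((ϖ • z) 0))) =
        (∫ z in Set.pi Set.univ (fun _ : Fin 1 => Set.Icc (0:ℝ) 1),
          (deriv N ((ϖ • z) 0) + σ ((ϖ • z) 0))) + c := by
      intro ϖ hϖ
      have hcongr : (∫ z in Set.pi Set.univ (fun _ : Fin 1 => Set.Icc (0:ℝ) 1),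
          (deriv Nt ((ϖ • z) 0) + σ ((ϖ • z) 0))) =
          ∫ z in Set.pi Set.univ (fun _ : Fin 1 => Set.Icc (0:ℝ) 1),
            ((deriv N ((ϖ • z) 0) + σ ((ϖ • z) 0)) + c) := by
        refine MeasureTheory.setIntegral_congr_fun (MeasurableSet.univ_pi fun _ => measurableSet_Icc)
          fun z hz => ?_
        rw [hderiv _ (hdil ϖ hϖ z hz)]
        ring
      have hint : MeasureTheory.IntegrableOn (fun z : Fin 1 → ℝ => deriv N ((ϖ • z) 0) + σ ((ϖ • z) 0))
          (Set.pi Set.univ (fun _ : Fin 1 => Set.Icc (0:ℝ) 1)) MeasureTheory.volume :=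
        (Literature.NumberTheory.Transcendental.KZ.DilationLogSector.integrableOn_dilate_one ha hb hN'c hϖ).add
          (Literature.NumberTheory.Transcendental.KZ.DilationLogSector.integrableOn_dilate_one ha hb hσc hϖ)
      have hconst : MeasureTheory.IntegrableOn (fun _ : Fin 1 → ℝ => c)
          (Set.pi Set.univ (fun _ : Fin 1 => Set.Icc (0:ℝ) 1)) MeasureTheory.volume :=
        continuousOn_const.integrableOn_compact (isCompact_univ_pi fun _ => isCompact_Icc)
      rw [hcongr, MeasureTheory.integral_add hint hconst,
        Literature.NumberTheory.Transcendental.KZ.DilationLogSector.setIntegral_cube_one_const]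
    -- the integrand in the statement, as `N' + σ`
    have hshape : ∀ ϖ : ℝ, (fun z : Fin 1 → ℝ => deriv N ((ϖ • z) 0) + ∑ k,
        (γ k * ((deriv (u k) ((ϖ • z) 0) * u k ((ϖ • z) 0) +
            deriv (v k) ((ϖ • z) 0) * v k ((ϖ • z) 0)) /
            (u k ((ϖ • z) 0) ^ 2 + v k ((ϖ • z) 0) ^ 2)) -
          δ k * ((deriv (v k) ((ϖ • z) 0) * u k ((ϖ • z) 0) -
            deriv (u k) ((ϖ • z) 0) * v k ((ϖ • z) 0)) /
            (u k ((ϖ • z) 0) ^ 2 + v k ((ϖ • z) 0) ^ 2)))) =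
        fun z => deriv N ((ϖ • z) 0) + σ ((ϖ • z) 0) := fun ϖ => by
      funext z; simp only [hσ]
    have hshapeT : ∀ ϖ : ℝ, (fun z : Fin 1 → ℝ => deriv Nt ((ϖ • z) 0) + ∑ k,
        (γ k * ((deriv (u k) ((ϖ • z) 0) * u k ((ϖ • z) 0) +
            deriv (v k) ((ϖ • z) 0) * v k ((ϖ • z) 0)) /
            (u k ((ϖ • z) 0) ^ 2 + v k ((ϖ • z) 0) ^ 2)) -
          δ k * ((deriv (v k) ((ϖ • z) 0) * u k ((ϖ • z) 0) -
            deriv (u k) ((ϖ • z) 0) * v k ((ϖ • z) 0)) /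
            (u k ((ϖ • z) 0) ^ 2 + v k ((ϖ • z) 0) ^ 2)))) =
        fun z => deriv Nt ((ϖ • z) 0) + σ ((ϖ • z) 0) := fun ϖ => by
      funext z; simp only [hσ]
    -- the period of `g̃ = Ñ' + σ` vanishes
    have h1 : (∫ z in Set.pi Set.univ (fun _ : Fin 1 => Set.Icc (0:ℝ) 1),
        (deriv Nt (((1:ℝ) • z) 0) + ∑ k,
          (γ k * ((deriv (u k) (((1:ℝ) • z) 0) * u k (((1:ℝ) • z) 0) +
              deriv (v k) (((1:ℝ) • z) 0) * v k (((1:ℝ) • z) 0)) /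
              (u k (((1:ℝ) • z) 0) ^ 2 + v k (((1:ℝ) • z) 0) ^ 2)) -
            δ k * ((deriv (v k) (((1:ℝ) • z) 0) * u k (((1:ℝ) • z) 0) -
              deriv (u k) (((1:ℝ) • z) 0) * v k (((1:ℝ) • z) 0)) /
              (u k (((1:ℝ) • z) 0) ^ 2 + v k (((1:ℝ) • z) 0) ^ 2))))) = 0 := by
      rw [hshapeT 1, hshift 1 ⟨zero_le_one, le_rfl⟩, ← hshape 1]
      have h := hsum
      have key : (m : ℝ) * ((∫ z in Set.pi Set.univ (fun _ : Fin 1 => Set.Icc (0:ℝ) 1),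
          (deriv N (((1:ℝ) • z) 0) + ∑ k,
            (γ k * ((deriv (u k) (((1:ℝ) • z) 0) * u k (((1:ℝ) • z) 0) +
                deriv (v k) (((1:ℝ) • z) 0) * v k (((1:ℝ) • z) 0)) /
                (u k (((1:ℝ) • z) 0) ^ 2 + v k (((1:ℝ) • z) 0) ^ 2)) -
              δ k * ((deriv (v k) (((1:ℝ) • z) 0) * u k (((1:ℝ) • z) 0) -
                deriv (u k) (((1:ℝ) • z) 0) * v k (((1:ℝ) • z) 0)) /
                (u k (((1:ℝ) • z) 0) ^ 2 + v k (((1:ℝ) • z) 0) ^ 2))))) + c) = 0 := by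
        rw [mul_add, hc, mul_div_cancel₀ _ hm']
        linarith
      exact (mul_eq_zero.mp key).resolve_left hm'
    obtain ⟨K, V, hVo, hVc, hKs, hKa, hid⟩ :=
      stub_liouvilleSector a b ha hb Nt hNts hNta A u v hus hvs hua hva hslit γ δ hγ hδ h1
    obtain ⟨G, V', hG, hGK⟩ := stub_twistedDiagonal 1 K V hVo hVc hKs hKa
    refine ⟨1, fun _ => 1 + 1, fun _ => G, fun _ => V', fun _ => Polynomial.C (m : ℝ), 0,
      fun _ => hG, ?_, ?_, ?_⟩
    · intro j k
      rw [Polynomial.coeff_C]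
      split_ifs
      · simpa using isAlgebraic_algebraMap (R := ℚ) (A := ℝ) (m : ℚ)
      · exact isAlgebraic_zero
    · intro k
      rw [Polynomial.coeff_zero]
      exact isAlgebraic_zero
    · intro ϖ hϖ
      have hidϖ := hid ϖ hϖ
      rw [hshapeT ϖ, hshift ϖ hϖ, ← hshape ϖ] at hidϖ
      -- `m₀ + m v_g = m (v_g + c) = m · (ϖ − 1) ∫ K = (ϖ − 1) m v_G`
      have : (m₀ : ℝ) + (m : ℝ) * (∫ z in Set.pi Set.univ (fun _ : Fin 1 => Set.Icc (0:ℝ) 1),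
          (deriv N ((ϖ • z) 0) + ∑ k,
            (γ k * ((deriv (u k) ((ϖ • z) 0) * u k ((ϖ • z) 0) +
                deriv (v k) ((ϖ • z) 0) * v k ((ϖ • z) 0)) /
                (u k ((ϖ • z) 0) ^ 2 + v k ((ϖ • z) 0) ^ 2)) -
              δ k * ((deriv (v k) ((ϖ • z) 0) * u k ((ϖ • z) 0) -
                deriv (u k) ((ϖ • z) 0) * v k ((ϖ • z) 0)) /
                (u k ((ϖ • z) 0) ^ 2 + v k ((ϖ • z) 0) ^ 2))))) =
          (m : ℝ) * ((∫ z in Set.pi Set.univ (fun _ : Fin 1 => Set.Icc (0:ℝ) 1),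
          (deriv N ((ϖ • z) 0) + ∑ k,
            (γ k * ((deriv (u k) ((ϖ • z) 0) * u k ((ϖ • z) 0) +
                deriv (v k) ((ϖ • z) 0) * v k ((ϖ • z) 0)) /
                (u k ((ϖ • z) 0) ^ 2 + v k ((ϖ • z) 0) ^ 2)) -
              δ k * ((deriv (v k) ((ϖ • z) 0) * u k ((ϖ • z) 0) -
                deriv (u k) ((ϖ • z) 0) * v k ((ϖ • z) 0)) /
                (u k ((ϖ • z) 0) ^ 2 + v k ((ϖ • z) 0) ^ 2))))) + c) := by
        rw [mul_add, hc, mul_div_cancel₀ _ hm']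
        ring
      rw [this, hidϖ, hGK ϖ hϖ]
      simp
      ring

end Summit.KontsevichZagierPeriods.LiftingCriteria.DilationLiftAtOne
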